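import Mathlib
import HarnessLib
import Summits.QuantumFields.YangMills.Theorems.HypercubicLimit.Negative.ReflectedDensity
import Summits.QuantumFields.YangMills.Theorems.FradkinShenkerFlowFiniteSusceptibilityWeakCouplingRPCauchySchwarz
import Summits.QuantumFields.YangMills.Theorems.FradkinShenkerFlowFiniteSusceptibilityWeakCouplingAxisIsotropy
import Summits.QuantumFields.YangMills.Theorems.LangevinControlUVOSLegsFromFemtoAndGapStubAssemblyLatticeDist
import Summits.QuantumFields.YangMills.Theorems.LangevinControlUVOSLegsFromFemtoAndGapStubAssemblyShiftDefect
import Literature.MathematicalPhysics.AQFT.OSAxiomsSchwinger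
import Literature.MathematicalPhysics.QuantumFieldTheory.OSData
import Literature.MathematicalPhysics.QuantumLattice.LatticeScalarField
import Literature.MathematicalPhysics.QuantumFieldTheory.LatticeGaugeStaticPotentialProofs
import Literature.Probability.LatticeModels.ThermodynamicLimit

/-!
# Block TRANSPORT of line `conditional-mean-telescoping` (crux stmt-QuantumFields-8646): slab
clustering along any coordinate axis

On the odd torus of side `2S+1` at coupling `β` (`μ_W = wilsonMeasure r.ρ β`), functionals `Y` of the
infinite lattice `ℤ⁴` are read through the periodic lift `torusLift (2S+1)`.  If EVERY bounded
measurable functional of the TIME slab `[1, T]` obeys the diagonal RP-spectral clustering inequality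
(reflection `Θ = GaugeConfig.timeReflect`, translation by `n e₀`, rate factor `θ`, slack `ε B²`), then
every bounded measurable functional of the `μ`-SLAB `[1, T]_μ` obeys the same inequality with the
transported reflection `Θ_μ = π Θ π` (`π = configPerm (Equiv.swap 0 μ)`) and translation by `n e_μ`.

Proof.  Let `P = configPermZd (Equiv.swap 0 μ)` be the axis swap of `ℤ⁴`-configurations.  Given a
`μ`-slab functional `Y`, the functional `Y ∘ P` is a time-slab functional (the swap carries the
`μ`-slab edges onto the time-slab edges), measurable and with the same bound; apply the hypothesis to
it.  The lift intertwines the swaps (`P ∘ lift = lift ∘ configPerm π`, tree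
`AxisIsotropy.configPermZd_torusLift`) and `P` conjugates the translation by `n e₀` to the one by
`n e_μ` (`AxisIsotropy.configPermZd_configShift`, `sitePermZd_single`); finally substitute
`U ↦ configPerm π U`, which preserves Wilson's torus measure (`wilsonMeasure_map_configPerm`) and is an
involution. [folklore]
-/

noncomputable section

open scoped SchwartzMap ComplexConjugate
open MeasureTheory Filter Topology
open Literature.MathematicalPhysics.AQFT Literature.MathematicalPhysics.QuantumLattice
open Literature.MathematicalPhysics.QuantumFieldTheory
open Literature.Probability.LatticeModels (box Site)
open Summit.QuantumFields.YangMills.Theorems.HypercubicLimit.Negative (torusPlaquette thetaZ)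
open Summit.QuantumFields.YangMills.Theorems.OSLegsFromFemtoAndGap (latticeDist torusMoment)

namespace Summit.QuantumFields.YangMills.Cruxes.HypercubicLimit.ConditionalMeanTelescoping

/-- (auxiliary, block TRANSPORT) The axis swap `configPerm (Equiv.swap a b)` of torus configurations
is an involution. [folklore] -/
theorem slabT_configPerm_swap_swap {d L : ℕ} {G : Type*} [MeasurableSpace G] (a b : Fin d)
    (U : GaugeConfig d L G) :
    configPerm (Equiv.swap a b) (configPerm (Equiv.swap a b) U) = U := by
  funext e
  simp only [configPerm_apply, Equiv.symm_swap]
  congr 1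
  refine Prod.ext ?_ ?_
  · funext j
    simp [sitePerm_apply, Equiv.symm_swap, Equiv.swap_apply_self]
  · exact Equiv.swap_apply_self _ _ _

/-- (auxiliary, block TRANSPORT) The swap `0 ↔ μ` carries a `μ`-slab functional to a time-slab
functional. [folklore] -/
theorem slabT_dependsOn_comp {G : Type*} [MeasurableSpace G] (T : ℕ) (μ : Fin 4)
    {Y : LGConfig 4 G → ℝ}
    (hD : DependsOn Y {e : Literature.MathematicalPhysics.QuantumLattice.ZdEdge 4 |
      1 ≤ e.1 μ ∧ e.1 μ + (if e.2 = μ then 1 else 0) ≤ T}) :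
    DependsOn (fun W : LGConfig 4 G => Y (configPermZd (Equiv.swap 0 μ) W))
      {e : Literature.MathematicalPhysics.QuantumLattice.ZdEdge 4 |
        1 ≤ e.1 0 ∧ e.1 0 + (if e.2 = 0 then 1 else 0) ≤ T} := by
  intro U V hUV
  change Y (configPermZd (Equiv.swap 0 μ) U) = Y (configPermZd (Equiv.swap 0 μ) V)
  refine hD fun e he => ?_
  simp only [configPermZd_apply]
  refine hUV _ ?_
  simp only [Set.mem_setOf_eq, sitePermZd_apply, Equiv.symm_symm, Equiv.swap_apply_left,
    Equiv.symm_apply_eq] at he ⊢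
  exact he

/-- (auxiliary, block TRANSPORT) Change of variables `U ↦ configPerm π U` in a Wilson torus
expectation. [folklore] -/
theorem slabT_integral_comp_configPerm {G : Type} [Group G] [TopologicalSpace G]
    [IsTopologicalGroup G] [CompactSpace G] [MeasurableSpace G] [BorelSpace G] (r : LatticeRep G)
    (β : ℝ) (S : ℕ) (π : Equiv.Perm (Fin 4)) (g : GaugeConfig 4 (2 * S + 1) G → ℝ) :
    ∫ U, g (configPerm π U) ∂(wilsonMeasure r.ρ β : Measure (GaugeConfig 4 (2 * S + 1) G)) =
      ∫ U, g U ∂(wilsonMeasure r.ρ β : Measure (GaugeConfig 4 (2 * S + 1) G)) := by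
  have h := integral_map_equiv (μ := (wilsonMeasure r.ρ β : Measure (GaugeConfig 4 (2 * S + 1) G)))
    (configPerm π) g
  rw [wilsonMeasure_map_configPerm r.ρ r.continuous β π] at h
  exact h.symm

/-- **Block TRANSPORT (slab clustering along any axis).** If on the odd torus of side `2S+1` every
bounded measurable functional of the TIME slab `[1, T]` obeys the diagonal RP-spectral clustering
inequality (reflection `Θ`, translation by `n e₀`, rate factor `θ`, slack `ε B²`), then every bounded
measurable functional of the `μ`-SLAB `[1, T]_μ` obeys the same inequality with the transported
reflection `Θ_μ = π Θ π` (`π` = the axis swap `0 ↔ μ`, tree `configPerm`) and translation by `n e_μ`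
(invariance of Wilson's torus measure under `configPerm`, intertwining of `torusLift`/`configShift`). -/
theorem rpBlock_slabTransport :
    ∀ (G : Type) [Group G] [TopologicalSpace G] [IsTopologicalGroup G] [CompactSpace G]
      [MeasurableSpace G] [BorelSpace G] (r : LatticeRep G) (β : ℝ) (S T n : ℕ) (θ ε : ℝ) (μ : Fin 4),
      (∀ (Y : LGConfig 4 G → ℝ) (B : ℝ), Measurable Y → (∀ U, |Y U| ≤ B) →
        DependsOn Y {e : Literature.MathematicalPhysics.QuantumLattice.ZdEdge 4 |
          1 ≤ e.1 0 ∧ e.1 0 + (if e.2 = 0 then 1 else 0) ≤ T} →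
          |(∫ U, Y (torusLift (2 * S + 1) (GaugeConfig.timeReflect U)) *
                Y (configShift (-Pi.single 0 (n : ℤ)) (torusLift (2 * S + 1) U))
              ∂(wilsonMeasure r.ρ β : Measure (GaugeConfig 4 (2 * S + 1) G))) -
            (∫ U, Y (torusLift (2 * S + 1) U)
              ∂(wilsonMeasure r.ρ β : Measure (GaugeConfig 4 (2 * S + 1) G))) ^ 2| ≤
            θ * ((∫ U, Y (torusLift (2 * S + 1) (GaugeConfig.timeReflect U)) * Y (torusLift (2 * S + 1) U)
                    ∂(wilsonMeasure r.ρ β : Measure (GaugeConfig 4 (2 * S + 1) G))) -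
                  (∫ U, Y (torusLift (2 * S + 1) U)
                    ∂(wilsonMeasure r.ρ β : Measure (GaugeConfig 4 (2 * S + 1) G))) ^ 2) +
              ε * B ^ 2) →
      ∀ (Y : LGConfig 4 G → ℝ) (B : ℝ), Measurable Y → (∀ U, |Y U| ≤ B) →
        DependsOn Y {e : Literature.MathematicalPhysics.QuantumLattice.ZdEdge 4 |
          1 ≤ e.1 μ ∧ e.1 μ + (if e.2 = μ then 1 else 0) ≤ T} →
          |(∫ U, Y (torusLift (2 * S + 1) (configPerm (Equiv.swap 0 μ)
                  (GaugeConfig.timeReflect (configPerm (Equiv.swap 0 μ) U)))) *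
                Y (configShift (-Pi.single μ (n : ℤ)) (torusLift (2 * S + 1) U))
              ∂(wilsonMeasure r.ρ β : Measure (GaugeConfig 4 (2 * S + 1) G))) -
            (∫ U, Y (torusLift (2 * S + 1) U)
              ∂(wilsonMeasure r.ρ β : Measure (GaugeConfig 4 (2 * S + 1) G))) ^ 2| ≤
            θ * ((∫ U, Y (torusLift (2 * S + 1) (configPerm (Equiv.swap 0 μ)
                      (GaugeConfig.timeReflect (configPerm (Equiv.swap 0 μ) U)))) * Y (torusLift (2 * S + 1) U)
                    ∂(wilsonMeasure r.ρ β : Measure (GaugeConfig 4 (2 * S + 1) G))) -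
                  (∫ U, Y (torusLift (2 * S + 1) U)
                    ∂(wilsonMeasure r.ρ β : Measure (GaugeConfig 4 (2 * S + 1) G))) ^ 2) +
              ε * B ^ 2 := by
  intro G _ _ _ _ _ _ r β S T n θ ε μ hdiag Y B hY hbY hDY
  -- the transported (time-slab) functional `Y ∘ P`
  have hY' : Measurable fun W : LGConfig 4 G => Y (configPermZd (Equiv.swap 0 μ) W) :=
    hY.comp (configPermZd (Equiv.swap 0 μ)).measurable
  have hbY' : ∀ W : LGConfig 4 G, |Y (configPermZd (Equiv.swap 0 μ) W)| ≤ B := fun W => hbY _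
  have h := hdiag (fun W : LGConfig 4 G => Y (configPermZd (Equiv.swap 0 μ) W)) B hY' hbY'
    (slabT_dependsOn_comp T μ hDY)
  simp only [Theorems.FiniteSusceptibilityWeakCoupling.AxisIsotropy.configPermZd_configShift,
    Theorems.FiniteSusceptibilityWeakCoupling.AxisIsotropy.configPermZd_torusLift,
    Theorems.FiniteSusceptibilityWeakCoupling.AxisIsotropy.sitePermZd_neg, sitePermZd_single,
    Equiv.swap_apply_left] at h
  -- change of variables `U ↦ configPerm π U` in the three pairings of the conclusion
  rw [← slabT_integral_comp_configPerm r β S (Equiv.swap 0 μ) (fun V =>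
        Y (torusLift (2 * S + 1) (configPerm (Equiv.swap 0 μ)
          (GaugeConfig.timeReflect (configPerm (Equiv.swap 0 μ) V)))) *
            Y (configShift (-Pi.single μ (n : ℤ)) (torusLift (2 * S + 1) V))),
    ← slabT_integral_comp_configPerm r β S (Equiv.swap 0 μ) (fun V => Y (torusLift (2 * S + 1) V)),
    ← slabT_integral_comp_configPerm r β S (Equiv.swap 0 μ) (fun V =>
        Y (torusLift (2 * S + 1) (configPerm (Equiv.swap 0 μ)
          (GaugeConfig.timeReflect (configPerm (Equiv.swap 0 μ) V)))) *
            Y (torusLift (2 * S + 1) V))]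
  simp only [slabT_configPerm_swap_swap]
  exact h

end Summit.QuantumFields.YangMills.Cruxes.HypercubicLimit.ConditionalMeanTelescoping

end
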